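import Summits.MatrixMultiplication.MatrixMultiplication.Theorems.SoloInformedCwTwoBoundary
import Literature.Barriers.MatrixMultiplication.UniversalMethodBarrierDegenerationPow
import HarnessLib

/-!
# The boundary of the orbit of `T_{cw,2}` through unital algebras (solo-informed, gen 25)

Third file of the §2n series (`SoloInformedCwTwoShadow`, `SoloInformedCwTwoBoundary`).  A binding
(`1_A`- and `1_B`-generic) tensor is isomorphic to the structure tensor of a unital algebra, and an
ALGEBRAIC degeneration of unital algebras (a curve of bases) is a tensor degeneration.  Three explicit
moves, each an integer certificate checked by `decide +kernel`:

1. THE FLAG.  `P = ∑_{σ∈𝔖₃} e_σ` is binding (pencil determinant `2ν₀ν₁ν₂`), `P ≅ T_{A_P}` for a commutative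
   unital algebra `A_P` on `ℂ³` which is NOT quadratic: `u = (-1,0,1)` has `1, u, u∗u` linearly independent.
   Rescaling the flag basis `(1, εu, ε²(u∗u))` is an algebraic degeneration `A_P → ℂ[t]/t³`
   (`(εu)² = ε²u∗u`, all other products of non-units vanish in the limit).  Certificate
   `sThree_truncPoly_check`: `P ⊵₂ 4·T_{ℂ[t]/t³}`; hence `T_{cw,2} ⊵ T_{ℂ[t]/t³}` (= the "big" `CW₁`,
   Nurmiev class `N₁₀`), which the coordinate searches of jobs j180146/j180682/j180880 had missed.
2. THE IDEMPOTENT.  The order-one limit `L` of `P` (class `N₃`, `SoloInformedCwTwoBoundary`) is binding;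
   its unital algebra `A_L` (unit `(12,8,0)` w.r.t. `e_A = e_B = x₀+x₁`) has the rational idempotent
   `e = (12,0,0)` with quotient eigenvalues `(λ, μ) = (0, 3)` of `(L_e, R_e)` on `A_L/⟨1,e⟩`.  Rescaling a
   complement `n ↦ εn` degenerates `A_L` to `B_{0,3}`, where
   `B_{λ,μ} := ⟨1, e, n ∣ e² = e, en = λn, ne = μn, n² = 0⟩`.
   Certificate `nThreeLimit_unitalIdem_three_check`: `L ⊵₁ 48·T_{B_{0,3}}` (class `N₅`, dimension `21`).
3. THE ISOTOPY.  Principal isotopes `x ∘ y = R_b⁻¹(x) ∗ L_a⁻¹(y)`, `a = 1+se`, `b = 1+te`, have isomorphic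
   tensors and turn `B_{λ,μ}` into `B_{λ',μ'}` with `λ' = λ(1+s)/(1+sλ)`, `μ' = μ(1+t)/(1+tμ)`; so the tensor
   class of `B_{λ,μ}` only sees whether `λ, μ ∈ {0}, {1}, ℂ∖{0,1}` (classes: `(g,g) ↦ N₃`, `(0,g),(g,0),(1,g),
   (g,1) ↦ N₅`, `(0,0),(1,1) ↦ N₈ ∋ T_{ℂ×ℂ[t]/t²}`, `(0,1),(1,0) ↦ N₁₁ ∋ T_{U₂} = T₂`, by rank profiles), and
   the degenerate isotopies `t → -1` (`b → 1-e`, not invertible) resp. `t → ∞` give DEGENERATIONS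
   `B_{0,μ} ⊵ B_{0,0} = T_{ℂ×ℂ[t]/t²}` and `B_{0,μ} ⊵ B_{0,1} ≅ T_{U₂}`.  Certificates
   `unitalIdem_three_zero_check` (`B_{0,3} ⊵₁ 4·B_{0,0}`) and `unitalIdem_three_one_check`
   (`B_{0,3} ⊵₂ 9·B_{0,1}`).

Chaining (`PolyDegeneratesTo.trans`): over `ℂ`, `T_{cw,2} ⊵ T_{ℂ[t]/t³}`, `⊵ T_{B_{0,3}}` (class `N₅`),
`⊵ T_{ℂ×ℂ[t]/t²}` (class `N₈`), `⊵ T_{B_{0,1}}`; and `T_{cw,2} ⊵ N₆ ⊵₁ M₇` with `M₇` in the class `N₇` of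
`T_{⟨1,a,b ∣ ab = a⟩}` (dimension `20`; toric certificate of job j181410, `nurmiev_six_nSevenLimit_check`).
CENSUS after this file — COMPLETE: of Nurmiev's `24` classes of nonzero nilpotent `3×3×3` tensors,
`N₁, N₂` (dimension `≥ 23`) and `N₄` (`rk ad² = 24 > 22` on `𝔤₁ → 𝔤₋₁`) are NOT below `T_{cw,2}`, and ALL
OTHER `21` classes ARE: kernel certificates reach the normal forms of `N₆, N₁₁, …, N₂₄`
(`SoloInformedCwTwoBoundary`), the structure tensors `T_{ℂ[t]/t³} ∈ N₁₀`, `T_{ℂ×ℂ[t]/t²} ∈ N₈`, and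
class representatives `L ∈ N₃`, `T_{B_{0,3}} ∈ N₅`, `M₇ ∈ N₇`, `M₉ ∈ N₉` (this file; classes identified by the `14`
exact ranks of `ad(T)^k` on graded `𝔢₆`, pairwise distinct over the table).
Sequel `SoloInformedCwTwoBoundaryRanks`: border rank `4` and (under door D1) asymptotic rank `3` for the
class representatives `L`, `T_{B_{0,3}}`, `N₆`, `M₇` (with `T₂`: the five border-rank-`4` classes below the door).
Scripts: HOME/work/g25/degen/{unital_algebra,unital_degens,idempotents,chain_certs,flag_cert,border3}.py.
-/

noncomputable section

open scoped BigOperators Polynomial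

namespace Summit.MatrixMultiplication.MatrixMultiplication.Theorems

open Literature.Computability.AlgebraicComplexity
open Literature.Barriers.MatrixMultiplication (PolyDegeneratesTo)

/-- `T_{ℂ[t]/t³}` in the basis `(1, t, t²)`. -/
def truncPolyInt : Fin 3 → Fin 3 → Fin 3 → ℤ :=
  ApproxCert.ofEntries 3 3 3
    [((0, 0, 0), 1), ((0, 1, 1), 1), ((1, 0, 1), 1), ((0, 2, 2), 1), ((2, 0, 2), 1), ((1, 1, 2), 1)]

/-- `T_{ℂ[t]/t³}` over a commutative ring. -/
def truncPoly (K : Type*) [CommRing K] : Fin 3 → Fin 3 → Fin 3 → K :=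
  fun i j l => (truncPolyInt i j l : K)

/-- `T_{B_{0,μ}}`, `B_{0,μ} = ⟨1, e, n ∣ e² = e, en = 0, ne = μn, n² = 0⟩`, basis `(1, e, n)`;
`B_{0,0} = ℂ × ℂ[t]/t²` (`e = (1,0)`, `n = (0,t)`), `B_{0,1} ≅ U₂`. -/
def unitalIdemInt (μ : ℤ) : Fin 3 → Fin 3 → Fin 3 → ℤ :=
  ApproxCert.ofEntries 3 3 3
    [((0, 0, 0), 1), ((0, 1, 1), 1), ((1, 0, 1), 1), ((0, 2, 2), 1), ((2, 0, 2), 1), ((1, 1, 1), 1),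
      ((2, 1, 2), μ)]

/-- `T_{B_{0,μ}}` over a commutative ring. -/
def unitalIdem (K : Type*) [CommRing K] (μ : ℤ) : Fin 3 → Fin 3 → Fin 3 → K :=
  fun i j l => (unitalIdemInt μ i j l : K)

/-- `M₇ = 2e₀₁₂ + 2e₁₂₀ - e₂₀₂ - e₂₁₀ + e₂₁₂ - 2e₂₂₁`, an order-one toric limit of Nurmiev's `N₆`
lying in the class `N₇` (orbit dimension `20`; rank profile `(20,22,20,15,15,17,10,12,12,7,9,7,4,3) = ` that of
`N₇ = e₀₀₂ + e₀₁₁ + e₀₂₀ + e₁₀₁ + e₂₁₀`). -/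
def nSevenLimitInt : Fin 3 → Fin 3 → Fin 3 → ℤ :=
  ApproxCert.ofEntries 3 3 3
    [((0, 1, 2), 2), ((1, 2, 0), 2), ((2, 0, 2), -1), ((2, 1, 0), -1), ((2, 1, 2), 1), ((2, 2, 1), -2)]

/-- `M₇` over a commutative ring. -/
def nSevenLimit (K : Type*) [CommRing K] : Fin 3 → Fin 3 → Fin 3 → K :=
  fun i j l => (nSevenLimitInt i j l : K)

/-- `M₉ = e₀₁₁ + e₀₂₁ + 4e₀₂₂ + 16e₁₂₂ - e₂₁₀ + e₂₂₀`, an order-one toric limit of `P` in the class `N₉` (orbit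
dimension `20`; rank profile `(20,18,20,11,11,18,4,9,9,2,9,2,2,0)` = that of `N₉ = e₀₀₀ + e₀₁₁ + e₁₁₁ + e₁₂₂`;
job j181410). -/
def nNineLimitInt : Fin 3 → Fin 3 → Fin 3 → ℤ :=
  ApproxCert.ofEntries 3 3 3
    [((0, 1, 1), 1), ((0, 2, 1), 1), ((0, 2, 2), 4), ((1, 2, 2), 16), ((2, 1, 0), -1), ((2, 2, 0), 1)]

/-- `M₉` over a commutative ring. -/
def nNineLimit (K : Type*) [CommRing K] : Fin 3 → Fin 3 → Fin 3 → K :=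
  fun i j l => (nNineLimitInt i j l : K)

/-- THE FLAG: `P ⊵₂ 4·T_{ℂ[t]/t³}` (frame `(1, u, u∗u)` of `A_P`, `u = (-1,0,1)`, weights `(0,1,2)`,
`(0,1,2)`, `(2,1,0)`). -/
theorem sThree_truncPoly_check :
    DegenCert.check 3 3 3 3 3 3 2 4 sThreeInt truncPolyInt
      ![![[1], [0, 1], [0, 0, -1]], ![[1], [], [0, 0, 1]], ![[1], [0, -1], [0, 0, -1]]]
      ![![[1], [0, 1], [0, 0, -1]], ![[1], [], [0, 0, 1]], ![[1], [0, -1], [0, 0, -1]]]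
      ![![[0, 0, 1], [0, -2], [1]], ![[], [], [-2]], ![[0, 0, 1], [0, 2], [1]]] = true := by
  decide +kernel

/-- THE IDEMPOTENT: `L ⊵₁ 48·T_{B_{0,3}}` (frame `(1, e, n)` of `A_L`, `e = (12,0,0)` idempotent with
`(λ,μ) = (0,3)`, weights `(0,0,1)`, `(0,0,1)`, `(1,1,0)`). -/
theorem nThreeLimit_unitalIdem_three_check :
    DegenCert.check 3 3 3 3 3 3 1 48 nThreeLimitInt (unitalIdemInt 3)
      ![![[2], [], []], ![[2], [2], [0, -1]], ![[], [], [0, 2]]]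
      ![![[1], [3], []], ![[1], [], []], ![[], [], [0, 1]]]
      ![![[], [0, 2], []], ![[0, 3], [0, -3], []], ![[], [], [8]]] = true := by
  decide +kernel

/-- THE ISOTOPY `t → -1`: `B_{0,3} ⊵₁ 4·B_{0,0}` (`b = (1-e) + εe`, new basis `(b, εe, n)`). -/
theorem unitalIdem_three_zero_check :
    DegenCert.check 3 3 3 3 3 3 1 4 (unitalIdemInt 3) (unitalIdemInt 0)
      ![![[4], [], []], ![[], [4], []], ![[], [], [-2, -3]]]
      ![![[1], [], []], ![[-1, 1], [0, 1], []], ![[], [], [1]]]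
      ![![[0, 1], [1, -1], []], ![[], [1], []], ![[], [], [0, 1]]] = true := by
  decide +kernel

/-- THE ISOTOPY `t → ∞`: `B_{0,3} ⊵₂ 9·B_{0,1}` (`b = 1 + e/ε`). -/
theorem unitalIdem_three_one_check :
    DegenCert.check 3 3 3 3 3 3 2 9 (unitalIdemInt 3) (unitalIdemInt 1)
      ![![[0, 9], [], []], ![[], [0, 9], []], ![[], [], [0, 3, -1]]]
      ![![[0, 1], [], []], ![[1], [1, 1], []], ![[], [], [1]]]
      ![![[1], [-1, 1, -1], []], ![[], [0, 1, -1], []], ![[], [], [0, 1]]] = true := by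
  decide +kernel

/-- `P ⊵₁ M₉` (order `1`, unit multiplier; weights `(1,1,0)`, `(2,0,0)`, `(1,0,0)`; job j181410). -/
theorem sThree_nNineLimit_check :
    DegenCert.check 3 3 3 3 3 3 1 1 sThreeInt nNineLimitInt
      ![![[], [0, 2], [-1]], ![[0, 1], [0, 2], []], ![[], [], [1]]]
      ![![[0, 0, 2], [], [-2]], ![[0, 0, -1], [1], [-1]], ![[0, 0, -1], [-1], [-1]]]
      ![![[], [-1], []], ![[0, -1], [1], [-2]], ![[], [], [-2]]] = true := by
  decide +kernel

/-- `N₆ ⊵₁ M₇` (order `1`, unit multiplier; weights `(0,1,0)`, `(1,1,0)`, `(0,1,0)`; job j181410). -/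
theorem nurmiev_six_nSevenLimit_check :
    DegenCert.check 3 3 3 3 3 3 1 1 (nurmievInt 6) nSevenLimitInt
      ![![[], [0, -2], [-1]], ![[], [], [1]], ![[2], [], []]]
      ![![[0, 1], [], [1]], ![[], [0, -1], []], ![[0, 1], [0, -1], []]]
      ![![[], [0, -1], [-1]], ![[-1], [], []], ![[-1], [0, 2], []]] = true := by
  decide +kernel

/-- **`P ⊵ T_{ℂ[t]/t³}`** over every field of characteristic `≠ 2`. -/
theorem sThree_polyDegeneratesTo_truncPoly (K : Type*) [Field K] (h2 : (2 : K) ≠ 0) :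
    PolyDegeneratesTo (sThree K) (truncPoly K) := by
  have hD : IsUnit (((4 : ℤ) : K)) := by
    rw [show ((4 : ℤ) : K) = (2 : K) ^ 2 by norm_num]
    exact isUnit_iff_ne_zero.mpr (pow_ne_zero _ h2)
  exact DegenCert.polyDegeneratesTo_of_check K sThree_truncPoly_check hD

/-- In characteristic `2`, `P ⋭ T_{ℂ[t]/t³}` (unital target, `not_polyDegeneratesTo_sThree_of_two_eq_zero`
with `ν = e₀*`), so over a field `P ⊵ T_{ℂ[t]/t³} ⟺ char ≠ 2`. -/
theorem sThree_polyDegeneratesTo_truncPoly_iff (K : Type*) [Field K] :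
    PolyDegeneratesTo (sThree K) (truncPoly K) ↔ (2 : K) ≠ 0 := by
  constructor
  · intro h h2
    refine not_polyDegeneratesTo_sThree_of_two_eq_zero K h2 (truncPoly K) ![1, 0, 0] ?_ h
    have : (Matrix.of fun b c => ∑ a, (![1, 0, 0] : Fin 3 → K) a * truncPoly K a b c) = 1 := by
      ext b c
      fin_cases b <;> fin_cases c <;>
        simp [truncPoly, truncPolyInt, ApproxCert.ofEntries, Fin.sum_univ_three]
    rw [this, Matrix.det_one]
    exact one_ne_zero
  · exact sThree_polyDegeneratesTo_truncPoly K

/-- **`T_{cw,2} ⊵ T_{ℂ[t]/t³}`** over `ℂ` (Nurmiev class `N₁₀`). -/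
theorem cwTensor_two_polyDegeneratesTo_truncPoly : PolyDegeneratesTo (cwTensor ℂ 2) (truncPoly ℂ) :=
  cwTensor_two_restrictsTo_sThree.trans_polyDegeneratesTo
    (sThree_polyDegeneratesTo_truncPoly ℂ two_ne_zero)

/-- **`P ⊵ T_{B_{0,3}}`** (class `N₅`) over every field of characteristic `≠ 2, 3`. -/
theorem sThree_polyDegeneratesTo_unitalIdem_three (K : Type*) [Field K] (h2 : (2 : K) ≠ 0)
    (h3 : (3 : K) ≠ 0) : PolyDegeneratesTo (sThree K) (unitalIdem K 3) := by
  have hD : IsUnit (((48 : ℤ) : K)) := by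
    rw [show ((48 : ℤ) : K) = (2 : K) ^ 4 * 3 by norm_num]
    exact isUnit_iff_ne_zero.mpr (mul_ne_zero (pow_ne_zero _ h2) h3)
  exact (sThree_polyDegeneratesTo_nThreeLimit K).trans
    (DegenCert.polyDegeneratesTo_of_check K nThreeLimit_unitalIdem_three_check hD)

/-- `B_{0,3} ⊵ B_{0,0} = T_{ℂ×ℂ[t]/t²}` over every field of characteristic `≠ 2`. -/
theorem unitalIdem_three_polyDegeneratesTo_zero (K : Type*) [Field K] (h2 : (2 : K) ≠ 0) :
    PolyDegeneratesTo (unitalIdem K 3) (unitalIdem K 0) := by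
  have hD : IsUnit (((4 : ℤ) : K)) := by
    rw [show ((4 : ℤ) : K) = (2 : K) ^ 2 by norm_num]
    exact isUnit_iff_ne_zero.mpr (pow_ne_zero _ h2)
  exact DegenCert.polyDegeneratesTo_of_check K unitalIdem_three_zero_check hD

/-- `B_{0,3} ⊵ B_{0,1} ≅ T_{U₂}` over every field of characteristic `≠ 3`. -/
theorem unitalIdem_three_polyDegeneratesTo_one (K : Type*) [Field K] (h3 : (3 : K) ≠ 0) :
    PolyDegeneratesTo (unitalIdem K 3) (unitalIdem K 1) := by
  have hD : IsUnit (((9 : ℤ) : K)) := by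
    rw [show ((9 : ℤ) : K) = (3 : K) ^ 2 by norm_num]
    exact isUnit_iff_ne_zero.mpr (pow_ne_zero _ h3)
  exact DegenCert.polyDegeneratesTo_of_check K unitalIdem_three_one_check hD

/-- **`T_{cw,2} ⊵ T_{B_{0,3}}`** over `ℂ` (Nurmiev class `N₅`, dimension `21`). -/
theorem cwTensor_two_polyDegeneratesTo_unitalIdem_three :
    PolyDegeneratesTo (cwTensor ℂ 2) (unitalIdem ℂ 3) :=
  cwTensor_two_restrictsTo_sThree.trans_polyDegeneratesTo
    (sThree_polyDegeneratesTo_unitalIdem_three ℂ two_ne_zero three_ne_zero)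

/-- **`T_{cw,2} ⊵ T_{ℂ×ℂ[t]/t²}`** over `ℂ` (Nurmiev class `N₈`):
`T_{cw,2} ⊵ P ⊵ L ⊵ T_{B_{0,3}} ⊵ T_{B_{0,0}}`. -/
theorem cwTensor_two_polyDegeneratesTo_unitalIdem_zero :
    PolyDegeneratesTo (cwTensor ℂ 2) (unitalIdem ℂ 0) :=
  cwTensor_two_polyDegeneratesTo_unitalIdem_three.trans
    (unitalIdem_three_polyDegeneratesTo_zero ℂ two_ne_zero)

/-- `T_{cw,2} ⊵ T_{B_{0,1}}` (`≅ T_{U₂}`) over `ℂ`, a second road to the class of `T₂`. -/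
theorem cwTensor_two_polyDegeneratesTo_unitalIdem_one :
    PolyDegeneratesTo (cwTensor ℂ 2) (unitalIdem ℂ 1) :=
  cwTensor_two_polyDegeneratesTo_unitalIdem_three.trans
    (unitalIdem_three_polyDegeneratesTo_one ℂ three_ne_zero)

/-- `P ⊵ M₉` over every commutative ring (class `N₉`). -/
theorem sThree_polyDegeneratesTo_nNineLimit (K : Type*) [CommRing K] :
    PolyDegeneratesTo (sThree K) (nNineLimit K) :=
  DegenCert.polyDegeneratesTo_of_check_one K sThree_nNineLimit_check

/-- **`T_{cw,2} ⊵ M₉`** over `ℂ` (Nurmiev class `N₉`, dimension `20`). -/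
theorem cwTensor_two_polyDegeneratesTo_nNineLimit :
    PolyDegeneratesTo (cwTensor ℂ 2) (nNineLimit ℂ) :=
  cwTensor_two_restrictsTo_sThree.trans_polyDegeneratesTo (sThree_polyDegeneratesTo_nNineLimit ℂ)

/-- `N₆ ⊵ M₇` over every commutative ring. -/
theorem nurmiev_six_polyDegeneratesTo_nSevenLimit (K : Type*) [CommRing K] :
    PolyDegeneratesTo (nurmiev K 6) (nSevenLimit K) :=
  DegenCert.polyDegeneratesTo_of_check_one K nurmiev_six_nSevenLimit_check

/-- `P ⊵ M₇` over every field of characteristic `≠ 2`. -/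
theorem sThree_polyDegeneratesTo_nSevenLimit (K : Type*) [Field K] (h2 : (2 : K) ≠ 0) :
    PolyDegeneratesTo (sThree K) (nSevenLimit K) :=
  (sThree_polyDegeneratesTo_nurmiev_six K h2).trans (nurmiev_six_polyDegeneratesTo_nSevenLimit K)

/-- **`T_{cw,2} ⊵ M₇`** over `ℂ` (Nurmiev class `N₇`, dimension `20`) — the last open row of the census. -/
theorem cwTensor_two_polyDegeneratesTo_nSevenLimit :
    PolyDegeneratesTo (cwTensor ℂ 2) (nSevenLimit ℂ) :=
  cwTensor_two_restrictsTo_sThree.trans_polyDegeneratesTo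
    (sThree_polyDegeneratesTo_nSevenLimit ℂ two_ne_zero)

end Summit.MatrixMultiplication.MatrixMultiplication.Theorems

end
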